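import Summits.Parity.BatemanHorn.Theorems.SoloInformedErdosNairClassIV
import Summits.Parity.BatemanHorn.Theorems.SoloInformedErdosNairParams

/-!
# Erdős's bound `∑_{n ≤ x} τ(|g(n)|) ≪ x log x`: classes I and IV at `w = N^{1/8}`, `z = N^{1/4}`

Solo informed line (Parity / Bateman–Horn), session 139.  The two Mertens-dependent class
estimates of the Shiu–Nair argument, specialised to the parameters `w = N^{1/8}`, `z = w² = N^{1/4}`,
`X = exp(d log N + C_g)` and converted with Mertens along `g` (both forms PROVED in the tree) into
`O_g(N log N)`:

* `classI_final` — `∑_{n ≤ N, m_n > z, P_n > w} τ(m_n) ≤ K_I · N log N` (`N ≥ 256`);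
* `classIV_final` — for a constant `L = L(g) ≥ 4`:
  `∑_{n ≤ N, m_n > z, L < P_n ≤ w, c_n > w} τ(m_n) ≤ K_IV · N log N` (`N ≥ 256`).

Everything is PROVED; no definitions, no named facts.

References: P. Shiu, J. reine angew. Math. 313 (1980) 161–170 [Shiu1980]; P. Erdős, J. London
Math. Soc. 27 (1952) 7–15 [Erdos1952]; M. Nair, Acta Arith. 62 (1992) 257–269 [Nair1992].
-/

open Finset Real Polynomial

namespace Summit.Parity.BatemanHorn.Theorems

open Literature.NumberTheory.Sieve

namespace ErdosDivisor

/-- The root-count data of an irreducible `g`: `ρ_g(p) ≤ D`, `ρ_g(p^a) ≤ W = D = d·M_g ≥ 1`.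
[cite: Hooley1964, Lemma 4]; [folklore] -/
theorem exists_rootCount_data {g : ℤ[X]} (hg : IsBatemanHornSystem ![g]) (hdeg : 0 < g.natDegree) :
    ∃ D : ℕ, (∀ p : ℕ, p.Prime → polyRootCountMod ![g] p ≤ D) ∧
      (∀ p : ℕ, p.Prime → ∀ a : ℕ, (polyRootCountMod ![g] (p ^ a) : ℝ) ≤ (D : ℝ)) ∧
      (1 : ℝ) ≤ (D : ℝ) := by
  have hirr : Irreducible g := by simpa using hg.irreducible 0
  obtain ⟨M, hM1, hM⟩ := exists_polyRootCountMod_prime_pow_le hirr hdeg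
  refine ⟨g.natDegree * M, fun p hp => by simpa using hM p hp 1,
    fun p hp a => by exact_mod_cast hM p hp a, ?_⟩
  have h1 : 1 ≤ g.natDegree * M := by
    have := Nat.mul_le_mul (Nat.one_le_of_lt hdeg) hM1
    simpa using this
  exact_mod_cast h1

/-- **Class I at `w = N^{1/8}`, `z = N^{1/4}`**: `∑_{n ≤ N, m_n > z, P_n > w} τ(m_n) ≤ K_I N log N`
for `N ≥ 256`. [cite: Shiu1980, §3 (∑_I)]; [this work] -/
theorem classI_final {g : ℤ[X]} (hg : IsBatemanHornSystem ![g]) (hdeg : 0 < g.natDegree) :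
    ∃ K : ℝ, ∀ N : ℕ, 256 ≤ N →
      ∑ n ∈ (Icc 1 N).filter (fun n : ℕ =>
          (N : ℝ) ^ (1 / 4 : ℝ) < (((g.eval (n : ℤ)).natAbs : ℕ) : ℝ) ∧
          (N : ℝ) ^ (1 / 8 : ℝ) < (Shiu.cutPrime ((N : ℝ) ^ (1 / 4 : ℝ)) (g.eval (n : ℤ)).natAbs : ℝ)),
          (#((g.eval (n : ℤ)).natAbs.divisors) : ℝ) ≤ K * ((N : ℝ) * Real.log N) := by
  classical
  have hg' := hg.hasNoFixedPrimeDivisor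
  obtain ⟨D, hD, hW, hW1⟩ := exists_rootCount_data hg hdeg
  obtain ⟨K, hK, hI⟩ := polyClassI_bound hg' hD hW hW1
  obtain ⟨C, hC0, hX⟩ := exists_eval_le_exp hdeg
  obtain ⟨Kup, hKup0, hup⟩ := exists_log_mul_prod_primesBelow_le hg
  obtain ⟨c, hc, hlow⟩ := exists_inv_sq_prod_le hg
  set M : ℕ := 8 * g.natDegree + ⌈8 * C⌉₊ with hM
  refine ⟨2 ^ M * K * ((16 * Kup + 4) / (16 * c ^ 2)), fun N hN => ?_⟩
  have hN1 : (1 : ℝ) ≤ N := by exact_mod_cast (by omega : 1 ≤ N)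
  have hN0 : (0 : ℝ) < N := by linarith
  obtain ⟨hw2, hwz, hlogw, hlogz, hzN, hℓ1, hℓ4⟩ := params hN
  obtain ⟨-, hw2z, h34, -, -, -, -⟩ := rpow_facts hN1
  set ℓ := Real.log N with hℓ
  set w := (N : ℝ) ^ (1 / 8 : ℝ) with hw
  set z := (N : ℝ) ^ (1 / 4 : ℝ) with hz
  have hℓ0 : 0 < ℓ := by linarith
  have hw0 : 0 < w := by linarith
  have hz1 : 1 ≤ z := by nlinarith
  have hz2 : 2 ≤ z := by nlinarith
  have hz0 : 0 ≤ z := by linarith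
  have hXle : Real.log (Real.exp (g.natDegree * ℓ + C)) / Real.log w ≤ M := by
    rw [Real.log_exp, hlogw]; exact log_ratio_le_eight _ hℓ1 hC0
  have h := hI N (Real.exp (g.natDegree * ℓ + C)) z w hz1 hw2 (hX N) M hXle
  refine h.trans ?_
  clear h hI
  set Pw := ∏ p ∈ Nat.primesBelow ⌈w⌉₊, (1 - (polyRootCountMod ![g] p : ℝ) / p) with hPw
  set Pz := ∏ p ∈ Nat.primesLE ⌊z⌋₊, (1 - (polyRootCountMod ![g] p : ℝ) / p) with hPz
  have hPw0 : 0 ≤ Pw :=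
    prod_nonneg fun p hp => (one_sub_rho_div_pos hg' (Nat.mem_primesBelow.1 hp).2).le
  have hPwle : Pw ≤ 8 * Kup / ℓ := by
    have h1 := hup w hw2
    rw [hlogw] at h1
    rw [le_div_iff₀ hℓ0]
    linarith
  have hPzle : (Pz ^ 2)⁻¹ ≤ (ℓ / 4 / c) ^ 2 := by
    have := hlow z hz2; rwa [hlogz] at this
  -- the two summands
  have hin : ((N : ℝ) + z) * Pw + w ^ 2 * z ≤ 16 * N * Kup / ℓ + (N : ℝ) ^ (1 / 2 : ℝ) := by
    rw [hw2z]
    have : ((N : ℝ) + z) * Pw ≤ (2 * N) * (8 * Kup / ℓ) :=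
      mul_le_mul (by linarith) hPwle hPw0 (by positivity)
    have h16 : (2 * (N : ℝ)) * (8 * Kup / ℓ) = 16 * N * Kup / ℓ := by ring
    linarith
  have hℓsq : (N : ℝ) ^ (1 / 2 : ℝ) * ℓ ^ 2 ≤ 4 * ((N : ℝ) * ℓ) := by
    have h1 : ℓ ^ 2 ≤ 4 * z * ℓ := by nlinarith
    calc (N : ℝ) ^ (1 / 2 : ℝ) * ℓ ^ 2 ≤ (N : ℝ) ^ (1 / 2 : ℝ) * (4 * z * ℓ) :=
          mul_le_mul_of_nonneg_left h1 (by positivity)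
      _ = 4 * ((N : ℝ) ^ (1 / 2 : ℝ) * z) * ℓ := by ring
      _ ≤ 4 * N * ℓ := by gcongr
      _ = 4 * ((N : ℝ) * ℓ) := by ring
  have hsum0 : 0 ≤ 16 * N * Kup / ℓ + (N : ℝ) ^ (1 / 2 : ℝ) := by positivity
  calc 2 ^ M * K * (((N : ℝ) + z) * Pw + w ^ 2 * z) * (Pz ^ 2)⁻¹
      ≤ 2 ^ M * K * (16 * N * Kup / ℓ + (N : ℝ) ^ (1 / 2 : ℝ)) * (ℓ / 4 / c) ^ 2 :=
        mul_le_mul (mul_le_mul_of_nonneg_left hin (by positivity)) hPzle (by positivity)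
          (by positivity)
    _ = 2 ^ M * K * ((16 * N * Kup * ℓ + (N : ℝ) ^ (1 / 2 : ℝ) * ℓ ^ 2) / (16 * c ^ 2)) := by
        field_simp
        ring
    _ ≤ 2 ^ M * K * ((16 * N * Kup * ℓ + 4 * ((N : ℝ) * ℓ)) / (16 * c ^ 2)) := by gcongr
    _ = 2 ^ M * K * ((16 * Kup + 4) / (16 * c ^ 2)) * ((N : ℝ) * ℓ) := by ring

/-- **Class IV at `w = N^{1/8}`, `z = N^{1/4}`**: for a constant `L = L(g) ≥ 4`,
`∑_{n ≤ N, m_n > z, L < P_n ≤ w, c_n > w} τ(m_n) ≤ K_IV N log N` for `N ≥ 256`.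
[cite: Shiu1980, §5 (∑_IV)]; [this work] -/
theorem classIV_final {g : ℤ[X]} (hg : IsBatemanHornSystem ![g]) (hdeg : 0 < g.natDegree) :
    ∃ L : ℝ, 4 ≤ L ∧ ∃ K : ℝ, ∀ N : ℕ, 256 ≤ N →
      ∑ n ∈ (Icc 1 N).filter (fun n : ℕ =>
          (N : ℝ) ^ (1 / 4 : ℝ) < (((g.eval (n : ℤ)).natAbs : ℕ) : ℝ) ∧
          L < (Shiu.cutPrime ((N : ℝ) ^ (1 / 4 : ℝ)) (g.eval (n : ℤ)).natAbs : ℝ) ∧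
          (Shiu.cutPrime ((N : ℝ) ^ (1 / 4 : ℝ)) (g.eval (n : ℤ)).natAbs : ℝ) ≤ (N : ℝ) ^ (1 / 8 : ℝ) ∧
          (N : ℝ) ^ (1 / 8 : ℝ) < (Shiu.cPart ((N : ℝ) ^ (1 / 4 : ℝ)) (g.eval (n : ℤ)).natAbs : ℝ)),
          (#((g.eval (n : ℤ)).natAbs.divisors) : ℝ) ≤ K * ((N : ℝ) * Real.log N) := by
  classical
  have hg' := hg.hasNoFixedPrimeDivisor
  obtain ⟨D, hD, hW, hW1⟩ := exists_rootCount_data hg hdeg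
  obtain ⟨K, hK, hIV⟩ := polyClassIV_bound hg' hD hW hW1
  obtain ⟨C, hC0, hX⟩ := exists_eval_le_exp hdeg
  obtain ⟨Kup, hKup0, hup⟩ := exists_log_mul_prod_primesBelow_le hg
  obtain ⟨c, hc, hlow⟩ := exists_inv_sq_prod_le hg
  set M₁ : ℕ := 4 * g.natDegree + ⌈4 * C⌉₊ with hM₁
  set K₁ : ℝ := 2 * M₁ * Real.log 2 + 4 * Real.log 2 with hK₁
  have hl2 := Real.log_two_gt_d9
  have hM₁0 : (0 : ℝ) ≤ M₁ := Nat.cast_nonneg _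
  have hK₁4 : 4 * Real.log 2 ≤ K₁ := by
    have : 0 ≤ 2 * (M₁ : ℝ) * Real.log 2 := by positivity
    linarith
  set L : ℝ := Real.exp (6 * K₁) with hL
  have hL4 : 4 ≤ L := by
    have := Real.add_one_le_exp (6 * K₁)
    norm_num at hl2
    linarith
  have hlogL : 6 * K₁ ≤ Real.log L := by rw [hL, Real.log_exp]
  set Λ : ℝ := Real.exp (2 * (D : ℝ) * (1 + (D : ℝ)) * Real.exp K₁ * (K₁ + 1)) with hΛ
  have hΛ0 : 0 < Λ := Real.exp_pos _
  refine ⟨L, hL4, 2 * 2 ^ M₁ * K * Λ * ((8 * Kup + 16) / (16 * c ^ 2)), fun N hN => ?_⟩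
  have hN1 : (1 : ℝ) ≤ N := by exact_mod_cast (by omega : 1 ≤ N)
  have hN0 : (0 : ℝ) < N := by linarith
  obtain ⟨hw2, hwz, hlogw, hlogz, hzN, hℓ1, hℓ4⟩ := params hN
  obtain ⟨hzz, -, -, h1112, -, -, -⟩ := rpow_facts hN1
  set ℓ := Real.log N with hℓ
  set w := (N : ℝ) ^ (1 / 8 : ℝ) with hw
  set z := (N : ℝ) ^ (1 / 4 : ℝ) with hz
  have hℓ0 : 0 < ℓ := by linarith
  have hw0 : 0 < w := by linarith
  have hz2 : 2 ≤ z := by nlinarith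
  have hz0 : 0 ≤ z := by linarith
  have hM₁le : Real.log (Real.exp (g.natDegree * ℓ + C)) / Real.log z ≤ M₁ := by
    rw [Real.log_exp, hlogz]; exact log_ratio_le_four _ hℓ1 hC0
  have h := hIV N (Real.exp (g.natDegree * ℓ + C)) z w L Kup M₁ hw2 hwz hL4 (hX N) hM₁le hlogL
    hKup0 hup
  rw [← hK₁, ← hΛ, hlogz] at h
  refine h.trans ?_
  clear h hIV
  set Pz := ∏ p ∈ Nat.primesLE ⌊z⌋₊, (1 - (polyRootCountMod ![g] p : ℝ) / p) with hPz
  have hPzle : (Pz ^ 2)⁻¹ ≤ (ℓ / 4 / c) ^ 2 := by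
    have := hlow z hz2; rwa [hlogz] at this
  -- the two summands
  have hA : ((N : ℝ) + z) * Kup / (ℓ / 4) ≤ 8 * N * Kup / ℓ := by
    rw [div_div_eq_mul_div]
    refine div_le_div_of_nonneg_right ?_ hℓ0.le
    have : ((N : ℝ) + z) * Kup ≤ 2 * N * Kup :=
      mul_le_mul_of_nonneg_right (by linarith) hKup0
    linarith
  have hZ0 : 0 ≤ z ^ (2 / 3 : ℝ) * z := by positivity
  have hZ : z ^ (2 / 3 : ℝ) * z * ℓ ^ 2 ≤ 16 * ((N : ℝ) * ℓ) := by
    have h1 : ℓ ^ 2 ≤ (4 * z) ^ 2 := pow_le_pow_left₀ hℓ0.le hℓ4 2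
    have h2 : (4 * z) ^ 2 = 16 * (N : ℝ) ^ (1 / 2 : ℝ) := by rw [← hzz]; ring
    rw [h2] at h1
    have h3 : z ^ (2 / 3 : ℝ) * z * ℓ ^ 2 ≤ z ^ (2 / 3 : ℝ) * z * (16 * (N : ℝ) ^ (1 / 2 : ℝ)) :=
      mul_le_mul_of_nonneg_left h1 hZ0
    have h4 : z ^ (2 / 3 : ℝ) * z * (16 * (N : ℝ) ^ (1 / 2 : ℝ)) =
        16 * (z ^ (2 / 3 : ℝ) * z * (N : ℝ) ^ (1 / 2 : ℝ)) := by ring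
    have h5 : (N : ℝ) ≤ N * ℓ := by nlinarith [mul_nonneg hN0.le (sub_nonneg.2 hℓ1)]
    linarith [h1112]
  have hsum0 : 0 ≤ 8 * N * Kup / ℓ + z ^ (2 / 3 : ℝ) * z := by positivity
  have hin : ((N : ℝ) + z) * Kup / (ℓ / 4) + z ^ (2 / 3 : ℝ) * z ≤
      8 * N * Kup / ℓ + z ^ (2 / 3 : ℝ) * z := by linarith
  calc 2 * 2 ^ M₁ * K * (((N : ℝ) + z) * Kup / (ℓ / 4) + z ^ (2 / 3 : ℝ) * z) * Λ * (Pz ^ 2)⁻¹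
      ≤ 2 * 2 ^ M₁ * K * (8 * N * Kup / ℓ + z ^ (2 / 3 : ℝ) * z) * Λ * (ℓ / 4 / c) ^ 2 :=
        mul_le_mul (mul_le_mul_of_nonneg_right (mul_le_mul_of_nonneg_left hin (by positivity))
          hΛ0.le) hPzle (by positivity) (by positivity)
    _ = 2 * 2 ^ M₁ * K * Λ *
          ((8 * N * Kup * ℓ + z ^ (2 / 3 : ℝ) * z * ℓ ^ 2) / (16 * c ^ 2)) := by
        field_simp
        ring
    _ ≤ 2 * 2 ^ M₁ * K * Λ * ((8 * N * Kup * ℓ + 16 * ((N : ℝ) * ℓ)) / (16 * c ^ 2)) := by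
        gcongr
    _ = 2 * 2 ^ M₁ * K * Λ * ((8 * Kup + 16) / (16 * c ^ 2)) * ((N : ℝ) * ℓ) := by ring

end ErdosDivisor

end Summit.Parity.BatemanHorn.Theorems
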